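import Summits.AtomisticToContinuum.HydrodynamicLimit.Theorems.TwoClocksTransferActivityTailsBlockAverageDock
import Summits.AtomisticToContinuum.HydrodynamicLimit.Theorems.TwoClocksTransferActivityTailsDriftEngineAvg
import Summits.AtomisticToContinuum.HydrodynamicLimit.Theorems.TwoClocksTransferActivityTailsPatternCostEngine
import Summits.AtomisticToContinuum.HydrodynamicLimit.Theorems.TwoClocksTransferActivityTailsTaggedSumMeasurable
import HarnessLib

/-!
# `TransferActivityTails` (stmt-AtomisticToContinuum-16624) from an exponential cost per heavy block and one-block UI
# (line `Sketch`, sibling card `heavy-block-pattern-cost`: the pattern-cost engine's dock; sorry-free)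

Crux `Summit.AtomisticToContinuum.HydrodynamicLimit.Theses.TwoClocks.TransferActivityTails` (route TwoClocks, rank 7).
With the objects and posits of `TwoClocksTransferActivityTailsBlockAverageDock.lean` (`BlockAct`, (PC) `HeavyBlockPatternCost τ₁`,
(UI₁) `OneBlockUI τ₁`, the dock `BlockAverageTails τ₁ ⟹ crux`), this file applies the landed abstract pattern-cost ⇒ LLN engine
(`TransferActivityTailsPatternCostEngine.stub_patternCostEngine`: dyadic layer cake + binomial pattern counting, `K₀(c₀, η)`
uniform; `E[ā𝟙{ā > 8y₀}] ≤ M′η + δ′`) to the measurable block variables `X_{i,j} = 𝟙_good · BlockAct`: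

* `patternCostEngineAvg` — per-sequence engine ⟹ particle-averaged engine (same `K₀(c₀, η)`; `ℝ≥0∞` bookkeeping with the
  helpers of `TransferActivityTailsDriftEngineAvg`);
* `blockAverageTails_of_patternCost` — engine statement → `HeavyBlockPatternCost τ₁` → `OneBlockUI τ₁` → `BlockAverageTails τ₁`
  (`V' := 8y₀`, `η := ε/(2(M′+1))`);
* `stub_patternCostReduction` — `(∃ τ₁ > 0, HeavyBlockPatternCost τ₁ ∧ OneBlockUI τ₁) → TwoClocks.TransferActivityTails` (registered).
Lead prover-line-stmt-AtomisticToContinuum-16624-c6-0; skeleton `Cruxes/TransferActivityTails/Lines/Sketch.lean`.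
-/

noncomputable section

open MeasureTheory Set Filter Topology
open scoped ENNReal BigOperators

namespace Summit.AtomisticToContinuum.HydrodynamicLimit.Theorems.TransferActivityTailsPatternCostDock

open Literature.MathematicalPhysics.KineticTheory Literature.Analysis.FluidPDE
open Summit.AtomisticToContinuum.HydrodynamicLimit.Theorems.ClampedTransferCoin
  (Flow Phase Rec window impulse window_pos collisionSum_Ioc_add_Ioc)
open Summit.AtomisticToContinuum.HydrodynamicLimit.Theorems.CollisionActivityTailsEndpointTails
  (tailFn tailFn_of_lt tailFn_of_le measurable_tailFn ae_mem_good_localGibbsLaw)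
open Summit.AtomisticToContinuum.HydrodynamicLimit.Theorems.TransferActivityTailsBlockDrift
  (actSummand BlockAct InCruxFrame PredictorDrift OneBlockUI HeavyBlockPatternCost BlockAverageTails
   actSummand_nonneg blockAct_nonneg collisionSum_nonneg_of_nonneg stub_blockAverageDock)

/-- **Particle-averaged pattern-cost engine** from the per-sequence one (the displayed antecedent, verbatim the registered
`stub_patternCostEngine`): `n` block sequences on one probability space, each with the dyadic pattern bound; an overshoot
bound for the particle AVERAGES; conclusion for the particle average of the tails, with the SAME `K₀(c₀, η)`. -/
theorem patternCostEngineAvg (hPat : ∀ c₀ η : ℝ, 3 ≤ c₀ → 0 < η → ∃ K₀ : ℕ, ∀ K : ℕ, K₀ ≤ K →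
        ∀ (Ω : Type) [MeasurableSpace Ω] (P : Measure Ω) [IsProbabilityMeasure P] (X : ℕ → Ω → ℝ) (y₀ M' δ' : ℝ),
          (∀ j, Measurable (X j)) → (∀ j ω, 0 ≤ X j ω) → 0 < y₀ → 0 ≤ M' → 0 ≤ δ' →
          (∀ m : ℕ, ∀ S : Finset (Fin K), S.Nonempty →
            P {ω | ∀ j ∈ S, y₀ * 2 ^ m < X j ω} ≤ ENNReal.ofReal (Real.exp (-((c₀ + 2 * m) * S.card)))) →
          (∑ j ∈ Finset.range K, ∫⁻ ω, ENNReal.ofReal (X j ω - M') ∂P ≤ ENNReal.ofReal (K * δ')) →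
          ∫⁻ ω, ENNReal.ofReal (Set.indicator {y : ℝ | 8 * y₀ < y} (fun y => y)
              ((K : ℝ)⁻¹ * ∑ j ∈ Finset.range K, X j ω)) ∂P ≤ ENNReal.ofReal (M' * η + δ')) :
    ∀ c₀ η : ℝ, 3 ≤ c₀ → 0 < η → ∃ K₀ : ℕ, ∀ K : ℕ, K₀ ≤ K →
    ∀ (Ω : Type) [MeasurableSpace Ω] (P : Measure Ω) [IsProbabilityMeasure P] (n : ℕ) (X : Fin n → ℕ → Ω → ℝ)
      (y₀ M' δ' : ℝ), 0 < n → (∀ i j, Measurable (X i j)) → (∀ i j ω, 0 ≤ X i j ω) → 0 < y₀ → 0 ≤ M' → 0 ≤ δ' →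
      (∀ i : Fin n, ∀ m : ℕ, ∀ S : Finset (Fin K), S.Nonempty →
        P {ω | ∀ j ∈ S, y₀ * 2 ^ m < X i j ω} ≤ ENNReal.ofReal (Real.exp (-((c₀ + 2 * m) * S.card)))) →
      (∀ j, j < K → ∫⁻ ω, ENNReal.ofReal ((n : ℝ)⁻¹ * ∑ i, max (X i j ω - M') 0) ∂P ≤ ENNReal.ofReal δ') →
      ∫⁻ ω, ENNReal.ofReal ((n : ℝ)⁻¹ * ∑ i, Set.indicator {y : ℝ | 8 * y₀ < y} (fun y => y)
          ((K : ℝ)⁻¹ * ∑ j ∈ Finset.range K, X i j ω)) ∂P ≤ ENNReal.ofReal (M' * η + δ') := by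
  intro c₀ η hc₀ hη
  obtain ⟨K₀, HK⟩ := hPat c₀ η hc₀ hη
  refine ⟨max K₀ 1, ?_⟩
  intro K hK Ω _ P _ n X y₀ M' δ' hn hXm hX0 hy₀ hM' hδ' hpat hOM'
  have hK₀K : K₀ ≤ K := le_trans (le_max_left _ _) hK
  have hK0 : 0 < K := lt_of_lt_of_le Nat.one_pos (le_trans (le_max_right _ _) hK)
  have hnR : (0 : ℝ) < n := by exact_mod_cast hn
  have hKR : (0 : ℝ) < K := by exact_mod_cast hK0
  -- summed single-time overshoot bounds
  have hOver : ∀ j ∈ Finset.range K, ∑ i, ∫⁻ ω, ENNReal.ofReal (X i j ω - M') ∂P ≤ n * ENNReal.ofReal δ' := by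
    intro j hj
    calc ∑ i, ∫⁻ ω, ENNReal.ofReal (X i j ω - M') ∂P
        = ∑ i, ∫⁻ ω, ENNReal.ofReal (max (X i j ω - M') 0) ∂P := by
          simp only [TransferActivityTailsDriftEngineAvg.ofReal_max_sub_zero]
      _ ≤ n * ENNReal.ofReal δ' :=
          TransferActivityTailsDriftEngineAvg.sum_lintegral_le_of_average_le hn (fun i ω => max (X i j ω - M') 0)
            (fun i => ((hXm i j).sub_const M').max measurable_const) (fun i ω => le_max_right _ _)
            (hOM' j (Finset.mem_range.1 hj))
  set Δ' : Fin n → ℝ≥0∞ := fun i => ∑ j ∈ Finset.range K, ∫⁻ ω, ENNReal.ofReal (X i j ω - M') ∂P with hΔ'def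
  have hΔ'sum : ∑ i, Δ' i ≤ K * (n * ENNReal.ofReal δ') := by
    calc ∑ i, Δ' i = ∑ j ∈ Finset.range K, ∑ i, ∫⁻ ω, ENNReal.ofReal (X i j ω - M') ∂P := Finset.sum_comm
      _ ≤ ∑ j ∈ Finset.range K, n * ENNReal.ofReal δ' := Finset.sum_le_sum hOver
      _ = K * (n * ENNReal.ofReal δ') := by rw [Finset.sum_const, Finset.card_range, nsmul_eq_mul]
  have hΔ'top : ∀ i, Δ' i ≠ ∞ := fun i => (ENNReal.lt_top_of_sum_ne_top
    (ne_top_of_le_ne_top (TransferActivityTailsDriftEngineAvg.natCast_mul_natCast_mul_ofReal_ne_top K n δ') hΔ'sum)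
    (Finset.mem_univ i)).ne
  set δi' : Fin n → ℝ := fun i => (Δ' i).toReal / K with hδi'def
  have hδi'0 : ∀ i, 0 ≤ δi' i := fun i => div_nonneg ENNReal.toReal_nonneg hKR.le
  have hH2 : ∀ i, Δ' i ≤ ENNReal.ofReal (K * δi' i) := fun i => by
    rw [show (K : ℝ) * δi' i = (Δ' i).toReal from mul_div_cancel₀ _ hKR.ne', ENNReal.ofReal_toReal (hΔ'top i)]
  -- the engine, particle by particle
  have hTail : ∀ i, ∫⁻ ω, ENNReal.ofReal (Set.indicator {y : ℝ | 8 * y₀ < y} (fun y => y)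
      ((K : ℝ)⁻¹ * ∑ j ∈ Finset.range K, X i j ω)) ∂P ≤ ENNReal.ofReal (M' * η + δi' i) := fun i =>
    HK K hK₀K Ω P (X i) y₀ M' (δi' i) (hXm i) (hX0 i) hy₀ hM' (hδi'0 i) (hpat i) (hH2 i)
  have hSD' : ∑ i, δi' i ≤ n * δ' := by
    have h1 : ∑ i, (Δ' i).toReal ≤ K * (n * δ') := by
      rw [← ENNReal.toReal_sum fun i _ => hΔ'top i]
      exact TransferActivityTailsDriftEngineAvg.toReal_le_of_le_natCast_mul hδ' hΔ'sum
    simp only [hδi'def]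
    rw [← Finset.sum_div, div_le_iff₀ hKR]
    exact h1.trans_eq (by ring)
  have hfin : (n : ℝ)⁻¹ * ∑ i, (M' * η + δi' i) ≤ M' * η + δ' := by
    rw [inv_mul_le_iff₀ hnR, Finset.sum_add_distrib, Finset.sum_const, Finset.card_univ, Fintype.card_fin,
      nsmul_eq_mul]
    nlinarith [hSD']
  -- average the `n` conclusions
  have hS : MeasurableSet {y : ℝ | 8 * y₀ < y} := measurableSet_Ioi
  have hT0 : ∀ i ω, 0 ≤ Set.indicator {y : ℝ | 8 * y₀ < y} (fun y => y)
      ((K : ℝ)⁻¹ * ∑ j ∈ Finset.range K, X i j ω) := fun i ω =>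
    Set.indicator_apply_nonneg fun _ =>
      mul_nonneg (inv_nonneg.2 hKR.le) (Finset.sum_nonneg fun j _ => hX0 i j ω)
  have hTm : ∀ i, Measurable fun ω => Set.indicator {y : ℝ | 8 * y₀ < y} (fun y => y)
      ((K : ℝ)⁻¹ * ∑ j ∈ Finset.range K, X i j ω) := fun i =>
    (measurable_id'.indicator hS).comp ((Finset.measurable_sum _ fun j _ => hXm i j).const_mul _)
  have hB0 : ∀ i, 0 ≤ M' * η + δi' i := fun i => by have := hδi'0 i; positivity
  calc ∫⁻ ω, ENNReal.ofReal ((n : ℝ)⁻¹ * ∑ i, Set.indicator {y : ℝ | 8 * y₀ < y} (fun y => y)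
        ((K : ℝ)⁻¹ * ∑ j ∈ Finset.range K, X i j ω)) ∂P
      = ENNReal.ofReal ((n : ℝ)⁻¹) * ∑ i, ∫⁻ ω, ENNReal.ofReal (Set.indicator {y : ℝ | 8 * y₀ < y}
          (fun y => y) ((K : ℝ)⁻¹ * ∑ j ∈ Finset.range K, X i j ω)) ∂P :=
        TransferActivityTailsDriftEngineAvg.lintegral_ofReal_mul_sum _
          (fun i ω => Set.indicator {y : ℝ | 8 * y₀ < y} (fun y => y) ((K : ℝ)⁻¹ * ∑ j ∈ Finset.range K, X i j ω))
          (inv_nonneg.2 hnR.le) (fun i _ => hTm i) (fun i _ => hT0 i)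
    _ ≤ ENNReal.ofReal ((n : ℝ)⁻¹) * ∑ i, ENNReal.ofReal (M' * η + δi' i) := by
        gcongr with i _
        exact hTail i
    _ = ENNReal.ofReal ((n : ℝ)⁻¹ * ∑ i, (M' * η + δi' i)) := by
        rw [ENNReal.ofReal_mul (inv_nonneg.2 hnR.le), ENNReal.ofReal_sum_of_nonneg fun i _ => hB0 i]
    _ ≤ ENNReal.ofReal (M' * η + δ') := ENNReal.ofReal_le_ofReal hfin

/-- **Block-average tails from the pattern-cost engine, (PC) and (UI₁)** (engine statement as the first hypothesis, verbatim
the registered `stub_patternCostEngine`).  `σ₀ := min σ₀^PC σ₀^UI 1/2`; `V' := 8y₀`; given `ε`: `M′` from (UI₁) at `ε/2`,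
`η := ε/(2(M′+1))`, `K₀ := K₀(c₀, η)` of the averaged engine; for `K ≥ K₀`, `N ≥ max N₀`: the averaged engine applied to
`X_{i,j} = 𝟙_good · BlockAct` gives `E[(N+1)⁻¹ Σ_i ā_i 𝟙{ā_i > 8y₀}] ≤ M′η + ε/2 ≤ ε`. -/
theorem blockAverageTails_of_patternCost (hPat : ∀ c₀ η : ℝ, 3 ≤ c₀ → 0 < η → ∃ K₀ : ℕ, ∀ K : ℕ, K₀ ≤ K →
        ∀ (Ω : Type) [MeasurableSpace Ω] (P : Measure Ω) [IsProbabilityMeasure P] (X : ℕ → Ω → ℝ) (y₀ M' δ' : ℝ),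
          (∀ j, Measurable (X j)) → (∀ j ω, 0 ≤ X j ω) → 0 < y₀ → 0 ≤ M' → 0 ≤ δ' →
          (∀ m : ℕ, ∀ S : Finset (Fin K), S.Nonempty →
            P {ω | ∀ j ∈ S, y₀ * 2 ^ m < X j ω} ≤ ENNReal.ofReal (Real.exp (-((c₀ + 2 * m) * S.card)))) →
          (∑ j ∈ Finset.range K, ∫⁻ ω, ENNReal.ofReal (X j ω - M') ∂P ≤ ENNReal.ofReal (K * δ')) →
          ∫⁻ ω, ENNReal.ofReal (Set.indicator {y : ℝ | 8 * y₀ < y} (fun y => y)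
              ((K : ℝ)⁻¹ * ∑ j ∈ Finset.range K, X j ω)) ∂P ≤ ENNReal.ofReal (M' * η + δ'))
    {τ₁ : ℝ} (hτ₁ : 0 < τ₁) (hPC : HeavyBlockPatternCost τ₁) (hUI : OneBlockUI τ₁) : BlockAverageTails τ₁ := by
  have hEng := patternCostEngineAvg hPat
  have hMeas := TransferActivityTailsTaggedSumMeasurable.stub_collisionSumMeasurable
  intro a₀ θ₀ u₀ ha hθ hu ha0 hθ0
  obtain ⟨σD, hσD, HD⟩ := hPC a₀ θ₀ u₀ ha hθ hu ha0 hθ0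
  obtain ⟨σU, hσU, HU⟩ := hUI a₀ θ₀ u₀ ha hθ hu ha0 hθ0
  refine ⟨min (min σD σU) 2⁻¹, lt_min (lt_min hσD hσU) (by norm_num), ?_⟩
  intro σ hσ hσlt T ρE θE uE hE Φ hlim t ht
  have hσD' : σ < σD := hσlt.trans_le ((min_le_left _ _).trans (min_le_left _ _))
  have hσU' : σ < σU := hσlt.trans_le ((min_le_left _ _).trans (min_le_right _ _))
  have hσ2 : σ < 2⁻¹ := hσlt.trans_le (min_le_right _ _)
  have hσ2' : σ < 1 / 2 := by rw [one_div]; exact hσ2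
  obtain ⟨y₀, c₀, hy₀, hc₀, QD⟩ := HD σ hσ hσD' T ρE θE uE hE Φ hlim t ht
  have QU := HU σ hσ hσU' T ρE θE uE hE Φ hlim t ht
  refine ⟨8 * y₀, by positivity, ?_⟩
  intro ε hε
  obtain ⟨M', hM'0, HM'⟩ := QU (ε / 2) (by positivity)
  set η : ℝ := ε / (2 * (M' + 1)) with hη
  have hηpos : 0 < η := by positivity
  obtain ⟨K₀, HK⟩ := hEng c₀ η hc₀ hηpos
  refine ⟨max K₀ 1, le_max_right _ _, ?_⟩
  intro K hK
  have hK₀K : K₀ ≤ K := le_trans (le_max_left _ _) hK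
  have hK1 : 1 ≤ K := le_trans (le_max_right _ _) hK
  have hKpos : (0 : ℝ) < K := by exact_mod_cast hK1
  obtain ⟨ND, HND⟩ := QD K hK1
  obtain ⟨NU', HNU'⟩ := HM' K hK1
  refine ⟨max ND NU', ?_⟩
  intro N hN s hs
  have hND : ND ≤ N := le_trans (le_max_left _ _) hN
  have hNU' : NU' ≤ N := le_trans (le_max_right _ _) hN
  -- the law, the block variables
  set P := localGibbsLaw σ a₀ u₀ θ₀ N (Φ N) with hP
  haveI hPprob : IsProbabilityMeasure P :=
    isProbabilityMeasure_localGibbsLaw ha hθ hu ha0 hθ0 (by linarith : σ ≤ 1 / 2) N (Φ N)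
  have hgood : ∀ᵐ z ∂P, z ∈ (Φ N).good := ae_mem_good_localGibbsLaw σ a₀ θ₀ u₀ N (Φ N)
  set X : Fin (N + 1) → ℕ → Phase N → ℝ := fun i j => (Φ N).good.indicator (BlockAct σ τ₁ (Φ N) i j s)
    with hX
  have hXgood : ∀ {z : Phase N}, z ∈ (Φ N).good → ∀ i j, X i j z = BlockAct σ τ₁ (Φ N) i j s z :=
    fun hz i j => Set.indicator_of_mem hz _
  have hXmeas : ∀ i j, Measurable (X i j) := by
    intro i j
    have heq : X i j = fun z => σ / τ₁ * (Φ N).good.indicator (fun z =>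
        (Φ N).collisionSum (Set.Ioc (s + j * window τ₁ N) (s + (j + 1) * window τ₁ N))
          (fun c => if c.fst = i then impulse c else 0) z) z := by
      funext z
      exact Set.indicator_const_mul _ _ _ _
    rw [heq]
    exact (hMeas σ N (Φ N) i _ _ hσ hσ2').const_mul _
  have hXnn : ∀ i j z, 0 ≤ X i j z := fun i j z =>
    Set.indicator_nonneg (fun z _ => blockAct_nonneg hσ.le hτ₁.le (Φ N) i j s z) z
  -- (PC) for the block variables (the events agree on the good set)
  have hpatX : ∀ i : Fin (N + 1), ∀ m : ℕ, ∀ S : Finset (Fin K), S.Nonempty →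
      P {ω | ∀ j ∈ S, y₀ * 2 ^ m < X i j ω} ≤ ENNReal.ofReal (Real.exp (-((c₀ + 2 * m) * S.card))) := by
    intro i m S hS
    have h := HND N hND s hs i m S hS
    have hset : {ω | ∀ j ∈ S, y₀ * 2 ^ m < X i j ω} =ᵐ[P] {z | ∀ j ∈ S, y₀ * 2 ^ m < BlockAct σ τ₁ (Φ N) i j s z} := by
      filter_upwards [hgood] with z hz
      show (∀ j ∈ S, y₀ * 2 ^ m < X i j z) = (∀ j ∈ S, y₀ * 2 ^ m < BlockAct σ τ₁ (Φ N) i j s z)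
      simp only [hXgood hz]
    rw [measure_congr hset]
    exact h
  -- (UI₁) for the block variables
  have hover' : ∀ j, j < K → ∫⁻ ω, ENNReal.ofReal (((N + 1 : ℕ) : ℝ)⁻¹ * ∑ i, max (X i j ω - M') 0) ∂P ≤
      ENNReal.ofReal (ε / 2) := by
    intro j hj
    have h := HNU' N hNU' s hs j hj
    have hl : ∀ᵐ ω ∂P, ENNReal.ofReal (((N + 1 : ℕ) : ℝ)⁻¹ * ∑ i, max (X i j ω - M') 0) =
        ENNReal.ofReal (((N : ℝ) + 1)⁻¹ * ∑ i : Fin (N + 1), max (BlockAct σ τ₁ (Φ N) i j s ω - M') 0) := by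
      filter_upwards [hgood] with ω hω
      simp only [hXgood hω, Nat.cast_succ]
    rw [lintegral_congr_ae hl]
    exact h
  -- THE ENGINE
  have hmain := HK K hK₀K (Phase N) P (N + 1) X y₀ M' (ε / 2) (Nat.succ_pos N) hXmeas hXnn hy₀ hM'0 (by positivity)
    hpatX hover'
  have hbound : M' * η + ε / 2 ≤ ε := by
    have h1 : M' * η ≤ ε / 2 := by
      rw [hη, mul_div_assoc', div_le_div_iff₀ (by positivity) (by norm_num : (0 : ℝ) < 2)]
      nlinarith
    linarith
  have hl : ∀ᵐ z ∂P, ENNReal.ofReal (((N : ℝ) + 1)⁻¹ * ∑ i : Fin (N + 1),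
      tailFn (8 * y₀) ((K : ℝ)⁻¹ * ∑ j ∈ Finset.range K, BlockAct σ τ₁ (Φ N) i j s z)) =
      ENNReal.ofReal (((N + 1 : ℕ) : ℝ)⁻¹ * ∑ i, tailFn (8 * y₀) ((K : ℝ)⁻¹ * ∑ j ∈ Finset.range K, X i j z)) := by
    filter_upwards [hgood] with z hz
    simp only [hXgood hz, Nat.cast_succ]
  rw [lintegral_congr_ae hl]
  exact hmain.trans (ENNReal.ofReal_le_ofReal hbound)

/-- **The crux from (PC) ∧ (UI₁) at one block length** (registered `stub_patternCostReduction`; the engine discharged by the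
landed `TransferActivityTailsPatternCostEngine.stub_patternCostEngine`, the kinematics by the landed dock `stub_blockAverageDock`). -/
theorem stub_patternCostReduction : (∃ τ₁ : ℝ, 0 < τ₁ ∧ HeavyBlockPatternCost τ₁ ∧ OneBlockUI τ₁) →
    Summit.AtomisticToContinuum.HydrodynamicLimit.Theses.TwoClocks.TransferActivityTails := by
  rintro ⟨τ₁, hτ₁, hP, hU⟩
  exact stub_blockAverageDock
    ⟨τ₁, hτ₁, blockAverageTails_of_patternCost TransferActivityTailsPatternCostEngine.stub_patternCostEngine hτ₁ hP hU⟩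

end Summit.AtomisticToContinuum.HydrodynamicLimit.Theorems.TransferActivityTailsPatternCostDock

end
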